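import Summits.ResolutionOfSingularities.ResolutionOfSingularities.Theses.PAlteration
import Summits.ResolutionOfSingularities.ResolutionOfSingularities.Theorems.PAlterationPialtStubRRStability
import Summits.ResolutionOfSingularities.ResolutionOfSingularities.Theorems.PAlterationPialtKnownCases
import Literature.AlgebraicGeometry.Resolution.SandwichedWeakPatching
import Literature.AlgebraicGeometry.Morphisms.NagataCompactification
import HarnessLib

/-!
# Sketch for `STUB-IDEAS-stub_radicialPatching-2.md` (stub-ideation k=2, RESHAPE) — crux `Pialt`
# (stmt-ResolutionOfSingularities-0555), line `SketchIdeator2` / Card A, stub `stub_radicialPatching`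

Helper-lemma STATEMENTS (sorried) + the sorry-free compositions `stub_of_picover_of_sand`,
`B1_…`, `B2_…`; elaboration sanity check only (no proving in this seat).

PLAN A (atlas induction + absorption of a REGULAR chart):
  stub ⇐ `Absorb p`                      (A7: induction on a finite RR atlas, A1/A2)
  `Absorb p` ⇐ `AbsorbRegular p`          (A6: Frobenius field normal form, A3 + in-tree ascent/descent)
  `AbsorbRegular p` ⇐ Picover(p, perfect k) ∧ `SandwichedWeakResolution p` ∧ Nagata   (A5, via A3–A5c)
PLAN B (exact gluing): `AbsorbRegular p` ⇐ `RelPicover p` ⇐ `RadicialSandwichedStrongResolution p` ∧ Nagata.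
-/

set_option linter.dupNamespace false

noncomputable section

open CategoryTheory CategoryTheory.Limits AlgebraicGeometry TopologicalSpace
open Literature.AlgebraicGeometry.Resolution
open Literature.AlgebraicGeometry.Morphisms (NagataCompactification)
open Summit.ResolutionOfSingularities.ResolutionOfSingularities.Theses.PAlteration (Picover)

namespace Summit.ResolutionOfSingularities.ResolutionOfSingularities.Theorems.Pialt.RadiciallyRegular.PatchingIdeas2

/-! ## Vocabulary — verbatim sub-shapes of the stub signature -/

/-- the stub's `hN` -/
def Normal (Z : Scheme.{0}) : Prop := ∀ z : Z, IsIntegrallyClosed (Z.presheaf.stalk z)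

/-- radicially regular (inner shape of the stub's `hL`) -/
def RR (Z : Scheme.{0}) : Prop :=
  ∃ (W : Scheme.{0}) (h : W ⟶ Z), IsIntegral W ∧ Scheme.IsRegular W ∧ IsFinite h ∧
    UniversallyInjective h ∧ Function.Surjective h.base

/-- the stub's `hL` -/
def LRR (Z : Scheme.{0}) : Prop := ∀ z : Z, ∃ U : Z.Opens, z ∈ U ∧ RR (U : Scheme.{0})

/-- the stub's conclusion (= conclusion of the crux at `Z`) -/
def PialtAt (Z : Scheme.{0}) : Prop :=
  ∃ (Z' : Scheme.{0}) (g : Z' ⟶ Z), IsProper g ∧ IsIntegral Z' ∧ Scheme.IsRegular Z' ∧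
    Function.Surjective g.base ∧ ∃ U : Z.Opens, Dense (U : Set Z) ∧ IsFinite (g ∣_ U) ∧
      UniversallyInjective (g ∣_ U)

/-- The route's crux `Picover` sliced at the prime `p` and at PERFECT ground fields (all Plan A
needs of it). -/
def PicoverPerfectAt (p : ℕ) : Prop :=
  ∀ (k : Type) [Field k] [CharP k p] [PerfectField k] (Y X : Scheme.{0}) (f : Y ⟶ Spec (.of k))
    (g : X ⟶ Y), IsSeparated f → LocallyOfFiniteType f → QuasiCompact f → IsIntegral Y →
    Scheme.IsRegular Y → IsIntegral X → IsFinite g → UniversallyInjective g →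
    Function.Surjective g.base → Scheme.HasResolution X

theorem picoverPerfectAt_of_picover (h : Picover) (p : ℕ) (hp : p.Prime) : PicoverPerfectAt p :=
  fun k _ _ _ Y X f g hs hl hq hY hreg hX hfin hui hsurj =>
    h p hp k Y X f g hs hl hq hY hreg hX hfin hui hsurj

/-! ## The two absorption statements -/

/-- ABSORPTION STEP: one RR chart `U` + an open `V` already satisfying the conclusion. -/
def Absorb (p : ℕ) : Prop :=
  ∀ (k : Type) [Field k] [CharP k p] [PerfectField k] (Z : Scheme.{0}) (f : Z ⟶ Spec (.of k)),
    IsSeparated f → LocallyOfFiniteType f → QuasiCompact f → IsIntegral Z → Normal Z →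
    ∀ (U V : Z.Opens), U ⊔ V = ⊤ → RR (U : Scheme.{0}) → PialtAt (V : Scheme.{0}) → PialtAt Z

/-- ABSORPTION OF A REGULAR CHART (normal form of `Absorb`): regular points impose no condition
on the conclusion of the crux. The whole local-to-global content of the stub. -/
def AbsorbRegular (p : ℕ) : Prop :=
  ∀ (k : Type) [Field k] [CharP k p] [PerfectField k] (Z : Scheme.{0}) (f : Z ⟶ Spec (.of k)),
    IsSeparated f → LocallyOfFiniteType f → QuasiCompact f → IsIntegral Z → Normal Z →
    ∀ (U V : Z.Opens), U ⊔ V = ⊤ → Scheme.IsRegular (U : Scheme.{0}) →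
      PialtAt (V : Scheme.{0}) → PialtAt Z

/-! ## Plan A helpers (sorried; sizes in the plan) -/

/-- A1 — finite RR atlas (quasi-compactness). -/
theorem A1_exists_finite_rrAtlas (k : Type) [Field k] (Z : Scheme.{0}) (f : Z ⟶ Spec (.of k))
    [QuasiCompact f] (hL : LRR Z) :
    ∃ (n : ℕ) (U : Fin n → Z.Opens), (⨆ i, U i) = ⊤ ∧ ∀ i, RR (U i : Scheme.{0}) := by
  sorry

/-- A2 — normality / LRR / RR pass to (non-empty) opens. -/
theorem A2_opens (Z : Scheme.{0}) [IsIntegral Z] (V : Z.Opens) (hV : (V : Set Z).Nonempty) :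
    (Normal Z → Normal (V : Scheme.{0})) ∧ (LRR Z → LRR (V : Scheme.{0})) ∧
      (RR Z → RR (V : Scheme.{0})) := by
  sorry

/-- A3 — FIELD NORMAL FORM (de Jong 1996, 4.17; in tree `FiniteCoverCompactification`:
`isPullback_toNormalization_fromNormalization`, `isFinite_fromNormalization_comp_ι`): a finite
radicial `w : W → U` over an open of a normal variety extends to a finite radicial cover
`h : Z₁ → Z` with `Z₁ ×_Z U = W` (`Z₁ :=` normalisation of `Z` in `W → U ⊆ Z`; universally
injective because `K(W)/K(Z)` is purely inseparable, `stub_functionFieldRadicial` +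
`universallyInjective_normalizationInι_of_isPurelyInseparable`). -/
theorem A3_exists_finite_radicial_cover_extending (k : Type) [Field k] (Z : Scheme.{0})
    [IsIntegral Z] (f : Z ⟶ Spec (.of k)) [LocallyOfFiniteType f] (hN : Normal Z) (U : Z.Opens)
    (W : Scheme.{0}) [IsIntegral W] (w : W ⟶ (U : Scheme.{0})) [IsFinite w]
    [UniversallyInjective w] (hw : Function.Surjective w.base) (hWn : Normal W) :
    ∃ (Z₁ : Scheme.{0}) (h : Z₁ ⟶ Z) (i : W ⟶ Z₁), IsIntegral Z₁ ∧ Normal Z₁ ∧ IsFinite h ∧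
      UniversallyInjective h ∧ Function.Surjective h.base ∧ IsOpenImmersion i ∧
        IsPullback i w h U.ι := by
  sorry

/-- A4 — TWO-PIECE GLUING over `Z = U ∪ V` (pushout along the common open `A`; in tree
`Limits/PushoutOpenImmersion`, `Morphisms/SeparatedGluing`; properness is local on the target). -/
theorem A4_exists_glue (Z : Scheme.{0}) [IsIntegral Z] (U V : Z.Opens) (hUV : U ⊔ V = ⊤)
    (G : Scheme.{0}) [IsIntegral G] (π : G ⟶ (U : Scheme.{0})) [IsProper π]
    (V₁ : Scheme.{0}) [IsIntegral V₁] (g : V₁ ⟶ (V : Scheme.{0})) [IsProper g]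
    (A : Scheme.{0}) [Nonempty A] (iG : A ⟶ G) (iV : A ⟶ V₁) [IsOpenImmersion iG]
    [IsOpenImmersion iV] (hcomm : iG ≫ π ≫ U.ι = iV ≫ g ≫ V.ι)
    (hrG : Set.range iG.base = (π ≫ U.ι).base ⁻¹' (V : Set Z))
    (hrV : Set.range iV.base = (g ≫ V.ι).base ⁻¹' (U : Set Z)) :
    ∃ (N : Scheme.{0}) (ρ : N ⟶ Z) (jG : G ⟶ N) (jV : V₁ ⟶ N), IsIntegral N ∧ IsProper ρ ∧
      IsOpenImmersion jG ∧ IsOpenImmersion jV ∧ jG ≫ ρ = π ≫ U.ι ∧ jV ≫ ρ = g ≫ V.ι ∧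
      iG ≫ jG = iV ≫ jV ∧ Set.range jG.base = ρ.base ⁻¹' (U : Set Z) ∧
      Set.range jV.base = ρ.base ⁻¹' (V : Set Z) := by
  sorry

/-- A5a — THE PICOVER SHAPE OVER THE REGULAR CHART: from a witness `g : V' → V` of the
conclusion on `V`, the relative normalisation `X := U^{K(V')} → U` (A3 over a dense open
`O' ⊆ U ∩ V` where `g` is finite radicial) and the proper BIRATIONAL comparison map
`a : g⁻¹(U ∩ V) → X ×_U (U ∩ V)` (universal property of the normalisation; birational because a
`K(U)`-endomorphism of the purely inseparable `K(V')` is the identity). -/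
theorem A5a_exists_picoverShape (k : Type) [Field k] (Z : Scheme.{0}) [IsIntegral Z]
    (f : Z ⟶ Spec (.of k)) [LocallyOfFiniteType f] (U V : Z.Opens) (hU : (U : Set Z).Nonempty)
    (hUreg : Scheme.IsRegular (U : Scheme.{0})) (V' : Scheme.{0}) [IsIntegral V']
    (g : V' ⟶ (V : Scheme.{0})) [IsProper g] (hV' : Scheme.IsRegular V')
    (hfin : ∃ O : (V : Scheme.{0}).Opens, Dense (O : Set (V : Scheme.{0})) ∧ IsFinite (g ∣_ O) ∧
      UniversallyInjective (g ∣_ O)) :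
    ∃ (X : Scheme.{0}) (g' : X ⟶ (U : Scheme.{0}))
      (a : (g ⁻¹ᵁ (V.ι ⁻¹ᵁ U) : Scheme.{0}) ⟶ (g' ⁻¹ᵁ (U.ι ⁻¹ᵁ V) : Scheme.{0})),
      IsIntegral X ∧ Normal X ∧ IsFinite g' ∧ UniversallyInjective g' ∧
      Function.Surjective g'.base ∧ IsProper a ∧ IsBirational a ∧
      a ≫ (g' ⁻¹ᵁ (U.ι ⁻¹ᵁ V)).ι ≫ g' ≫ U.ι = (g ⁻¹ᵁ (V.ι ⁻¹ᵁ U)).ι ≫ g ≫ V.ι := by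
  sorry

/-- A5b — RESOLVABILITY ASCENDS ALONG MODIFICATIONS, given the sandwiched WEAK atom (roof
`T` of `V₀ → X ← R` with `R → X` a resolution: `T → R` is proper birational over a regular
scheme, so `T`, hence `V₀`, is resolvable; descent `Scheme.HasResolution.of_isBirational`). -/
theorem A5b_hasResolution_of_modification (p : ℕ) (hS : SandwichedWeakResolution.{0} p)
    (k : Type) [Field k] [CharP k p] (X V₀ : Scheme.{0}) [IsIntegral X] [IsIntegral V₀]
    (f : X ⟶ Spec (.of k)) [IsSeparated f] [LocallyOfFiniteType f] [QuasiCompact f]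
    (ρ : V₀ ⟶ X) [IsProper ρ] (hρ : IsBirational ρ) (hX : Scheme.HasResolution X) :
    Scheme.HasResolution V₀ := by
  sorry

/-- A5c — NAGATA EXTENSION WITH PRESCRIBED OPEN (pattern `SandwichedGluing.extension_of_nagata`):
a proper `a : A → O` over an open `O ⊆ S` is `ρ⁻¹(O)` for a proper `ρ : V₀ → S` with `V₀`
integral; `ρ` is birational when `a` is. -/
theorem A5c_exists_proper_extension (hNag : NagataCompactification.{0}) (S : Scheme.{0})
    [IsIntegral S] [CompactSpace S] [QuasiSeparatedSpace S] [IsLocallyNoetherian S]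
    (O : S.Opens) (A : Scheme.{0}) [IsIntegral A] (a : A ⟶ (O : Scheme.{0})) [IsProper a] :
    ∃ (V₀ : Scheme.{0}) (ρ : V₀ ⟶ S) (i : A ⟶ V₀), IsIntegral V₀ ∧ IsProper ρ ∧
      IsOpenImmersion i ∧ IsPullback i a ρ O.ι ∧ (IsBirational a → IsBirational ρ) := by
  sorry

/-- A5 — ABSORBING THE REGULAR CHART modulo Picover (perfect `k`, prime `p`) and the sandwiched
weak atom: with `g : V' → V`, `X`, `a` from A5a — resolve `X` (Picover), extend `a` over `X`
(A5c) to `V₀ → X`, resolve `V₀` weakly (A5b) by `R₀`, pull the open `A = g⁻¹(U ∩ V)` back to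
`A' ⊆ R₀`, extend the modification `A' → A ⊆ V'` over the REGULAR `V'` (A5c) to `V₁ → V'`, glue
`R₀` and `V₁` along `A'` (A4) to `N → Z` proper; `N ∖ V₁ ⊆ R₀` is regular and `V₁` is proper
birational over the regular `V'`, so `SandwichedWeakResolution p` resolves `N`; `Ñ → N → Z` is the
witness (finite radicial over `g(g⁻¹O ∩ iso-locus) ⊆ V`, dense). -/
theorem A5_absorbRegular_of_picover_of_sand (p : ℕ) (hp : p.Prime)
    (hNag : NagataCompactification.{0}) (hPc : PicoverPerfectAt p)
    (hS : SandwichedWeakResolution.{0} p) : AbsorbRegular p := by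
  sorry

/-- A6 — FIELD NORMALISATION: `Absorb` from `AbsorbRegular` (A3 gives `h : Z₁ → Z` finite
radicial surjective with `h⁻¹U ≅ W` regular; the conclusion ascends to `h⁻¹V` and descends from
`Z₁`: `pialtConclusion_of_finite_universallyInjective_surjective(_perfectField)`, in tree). -/
theorem A6_absorb_of_absorbRegular (p : ℕ) (hp : p.Prime) (h : AbsorbRegular p) : Absorb p := by
  sorry

/-- A7 — ATLAS INDUCTION: the stub (signature verbatim) from `Absorb` (A1, A2; base case
`pialtShape_of_radiciallyRegular`). -/
theorem A7_stub_of_absorb (p : ℕ) (hp : p.Prime) (h : Absorb p) (k : Type) [Field k] [CharP k p]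
    [PerfectField k] (Z : Scheme.{0}) (f : Z ⟶ Spec (.of k)) [IsSeparated f]
    [LocallyOfFiniteType f] [QuasiCompact f] [IsIntegral Z]
    (hN : ∀ z : Z, IsIntegrallyClosed (Z.presheaf.stalk z))
    (hL : ∀ z : Z, ∃ U : Z.Opens, z ∈ U ∧ ∃ (W : Scheme.{0}) (h : W ⟶ (U : Scheme.{0})),
      IsIntegral W ∧ Scheme.IsRegular W ∧ IsFinite h ∧ UniversallyInjective h ∧
        Function.Surjective h.base) :
    ∃ (Z' : Scheme.{0}) (g : Z' ⟶ Z), IsProper g ∧ IsIntegral Z' ∧ Scheme.IsRegular Z' ∧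
      Function.Surjective g.base ∧ ∃ U : Z.Opens, Dense (U : Set Z) ∧ IsFinite (g ∣_ U) ∧
        UniversallyInjective (g ∣_ U) := by
  sorry

/-- ASSEMBLY (sorry-free modulo A5–A7): `stub_radicialPatching` holds at `p` modulo
Picover (sliced) ∧ `SandwichedWeakResolution p` ∧ Nagata. -/
theorem stub_of_picover_of_sand (p : ℕ) (hp : p.Prime) (hNag : NagataCompactification.{0})
    (hPc : PicoverPerfectAt p) (hS : SandwichedWeakResolution.{0} p) (k : Type) [Field k]
    [CharP k p] [PerfectField k] (Z : Scheme.{0}) (f : Z ⟶ Spec (.of k)) [IsSeparated f]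
    [LocallyOfFiniteType f] [QuasiCompact f] [IsIntegral Z]
    (hN : ∀ z : Z, IsIntegrallyClosed (Z.presheaf.stalk z))
    (hL : ∀ z : Z, ∃ U : Z.Opens, z ∈ U ∧ ∃ (W : Scheme.{0}) (h : W ⟶ (U : Scheme.{0})),
      IsIntegral W ∧ Scheme.IsRegular W ∧ IsFinite h ∧ UniversallyInjective h ∧
        Function.Surjective h.base) :
    ∃ (Z' : Scheme.{0}) (g : Z' ⟶ Z), IsProper g ∧ IsIntegral Z' ∧ Scheme.IsRegular Z' ∧
      Function.Surjective g.base ∧ ∃ U : Z.Opens, Dense (U : Set Z) ∧ IsFinite (g ∣_ U) ∧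
        UniversallyInjective (g ∣_ U) :=
  A7_stub_of_absorb p hp
    (A6_absorb_of_absorbRegular p hp (A5_absorbRegular_of_picover_of_sand p hp hNag hPc hS))
    k Z f hN hL

/-! ## Plan B — exact gluing through ONE strong atom -/

/-- RELATIVE PICOVER (extension form): a resolution of a finite radicial cover `X` of a regular
`Y`, prescribed over an open `Y₀`, extends to a resolution of `X`. -/
def RelPicover (p : ℕ) : Prop :=
  ∀ (k : Type) [Field k] [CharP k p] [PerfectField k] (Y X : Scheme.{0}) (f : Y ⟶ Spec (.of k))
    (g : X ⟶ Y), IsSeparated f → LocallyOfFiniteType f → QuasiCompact f → IsIntegral Y →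
    Scheme.IsRegular Y → IsIntegral X → IsFinite g → UniversallyInjective g →
    Function.Surjective g.base →
    ∀ (Y₀ : Y.Opens) (A : Scheme.{0}) (a : A ⟶ (g ⁻¹ᵁ Y₀ : Scheme.{0})), IsIntegral A →
      IsProper a → IsBirational a → Scheme.IsRegular A →
      ∃ (G : Scheme.{0}) (π : G ⟶ X) (i : A ⟶ G), IsResolution π ∧ IsOpenImmersion i ∧
        IsPullback i a π (g ⁻¹ᵁ Y₀).ι

/-- RADICIAL SANDWICHED STRONG RESOLUTION: strong (iso over `Reg`) resolution of integral schemes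
proper and generically finite radicial over a regular variety (⊇ `SandwichedStrongResolution p`,
⊇ a strong `Picover`; Cossart–Piltant 2019 (i)–(ii) in dim ≤ 3; NOT implied by the weak summit). -/
def RadicialSandwichedStrongResolution (p : ℕ) : Prop :=
  ∀ (k : Type) [Field k] [CharP k p] (U V : Scheme.{0}) (f : U ⟶ Spec (.of k)) (η : V ⟶ U),
    IsSeparated f → LocallyOfFiniteType f → QuasiCompact f → IsIntegral U →
    Scheme.IsRegular U → IsIntegral V → IsProper η →
    (∃ W : U.Opens, Dense (W : Set U) ∧ IsFinite (η ∣_ W) ∧ UniversallyInjective (η ∣_ W)) →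
      ∃ (Y : Scheme.{0}) (π : Y ⟶ V), IsResolution π ∧
        ∃ O : V.Opens, (O : Set V) = Scheme.regularLocus V ∧ IsIso (π ∣_ O)

theorem B1_absorbRegular_of_relPicover (p : ℕ) (hp : p.Prime) (h : RelPicover p) :
    AbsorbRegular p := by
  sorry

theorem B2_relPicover_of_rsand (p : ℕ) (hNag : NagataCompactification.{0})
    (h : RadicialSandwichedStrongResolution p) : RelPicover p := by
  sorry

/-! ## Plan C — calibrations that land now (sorry-free) -/

theorem C1_stub_of_dim_le_three (hCP : CossartPiltant2019.{0}) (p : ℕ) (k : Type) [Field k]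
    [CharP k p] (Z : Scheme.{0}) (f : Z ⟶ Spec (.of k)) [IsSeparated f] [LocallyOfFiniteType f]
    [QuasiCompact f] [IsIntegral Z] (hdim : topologicalKrullDim Z ≤ 3) : PialtAt Z :=
  pialtConclusion_of_dim_le_three hCP k Z f hdim

theorem C2_stub_of_resolutionInChar (p : ℕ) (h : ResolutionInChar.{0} p) (k : Type) [Field k]
    [CharP k p] (Z : Scheme.{0}) (f : Z ⟶ Spec (.of k)) [IsSeparated f] [LocallyOfFiniteType f]
    [QuasiCompact f] [IsIntegral Z] : PialtAt Z :=
  pialtConclusion_of_hasResolution Z (h k Z f inferInstance inferInstance inferInstance inferInstance)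

/-- C3 — both Plan-A atoms are consequences of resolution in characteristic `p` (in tree:
`sandwichedWeakResolution_of_resolutionInChar`; Picover trivially), so Plan A never proves more
than the summit. -/
theorem C3_atoms_of_resolutionInChar (p : ℕ) (h : ResolutionInChar.{0} p) :
    SandwichedWeakResolution.{0} p ∧ PicoverPerfectAt p :=
  ⟨sandwichedWeakResolution_of_resolutionInChar h,
    fun k _ _ _ Y X f g hs hl hq _ _ hX hfin _ _ => by
      haveI := hs; haveI := hl; haveI := hq; haveI := hX; haveI := hfin
      haveI : IsSeparated (g ≫ f) := inferInstance
      haveI : LocallyOfFiniteType (g ≫ f) := inferInstance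
      haveI : QuasiCompact (g ≫ f) := inferInstance
      exact h k X (g ≫ f) inferInstance inferInstance inferInstance inferInstance⟩

end Summit.ResolutionOfSingularities.ResolutionOfSingularities.Theorems.Pialt.RadiciallyRegular.PatchingIdeas2

end
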